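import Summits.BirchSwinnertonDyer.BirchSwinnertonDyer.Theorems.QuadraticBranchSignedControlPlusEtaNonsurjThetaFunctionalEquationNormCoordinateRankBound
import HarnessLib

/-!
# Route `QuadraticBranchSignedControl` (rung K8, cell `bsd-potss`), residual crux `PlusEtaMainConjectureNonsurj`
# (stmt-BirchSwinnertonDyer-19606): THE FUNCTIONAL EQUATION ON THE QUADRATIC BRANCH, XXXIX — THE MINIMAL-`λ` ROWS OFF THE ONTO LOCUS:
# **`L_p⁺(V, η, X) = u·T^{rank W}` (`μ_an = 0`, `λ_an = rank W`: no extra zeros) ⟹ `Char X⁺(V/K_∞)^η = (p^{μ_alg}·L_p⁺(V, η, X))` on ANY row,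
# tower onto or not — NO Kim 3.11η, NO (A), NO algebraic input**; (C1⁺_η) there ⟺ `μ_alg = 0` (seat `bsd-potss-k8eta-c2` g31; kernel;
# CONDITIONAL on Kobayashi 1.2 / 1.3 / 2.2η / 4.1η in hypothesis position)

WHY. Part XXXVIII removed the tower-onto hypothesis from the `η`-rank bound (`T^{rank W} ∣ Char X^η`) and settled the main conjecture up to
`p^{μ_alg}` on a non-onto row with an IRREDUCIBLE norm polynomial `H_an` of positive degree, at the price of one algebraic zero pair. The
`k = 0` rows need neither: when `L_p⁺(V, η, X) = u·T^{r}`, `r = rank W`, `u ∈ Λˣ` — the 8 level-4 rows of P-30Z/P-31F with `λ = r₀`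
(cm256j8000_1, cm27a4_m4, cm36a2_1, cm49a1_1, cmsextic_1, cmsextic_4, cmsextic_m16, cmsextic_m27: ALL CM, hence ALL non-onto, i.e. rows of THIS
crux) — Kobayashi's Thm. 4.1η with slack gives `g ∣ pⁿ·u·T^r`, so the Weierstrass polynomial of `g` divides `T^r` and is `T^j`, `j ≤ r`; the rank
bound gives `j ≥ r`; hence **`g = p^{μ(g)}·T^r·unit` and `Char X^η = (p^{μ(g)}·Lη)`, `μ(g) ≤ n`**. So on these rows the `η`-main conjecture of
the crux is EXACTLY the statement `μ(X⁺(V/K_∞)^η) = 0` — the `μ`-part isolated with no functional equation, no (A), no congruence.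

MATHEMATICS. Part XXXII `exists_weierstrass_quotient_of_dvd` / `weierstrass_dvd_iff` (`g ∣ pⁿL` ⟹ `P_g ∣ T^r` in `ℤ_p[T]`); `T` is prime in `ℤ_p[T]`, so a
monic divisor of `T^r` is `T^j` (Mathlib `dvd_prime_pow`, `eq_of_monic_of_associated`); `T^r ∣ g` ⟹ `r ≤ ord_T g = j`; spans.

WHAT (3 theorems). §115 `eq_X_pow_of_monic_dvd_X_pow`, **`span_eq_C_pow_mul_of_minimalShape`** (pure algebra: `L = u·T^r`, `T^r ∣ g ∣ pⁿL` ⟹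
`(g) = (p^{μ(g)}·L)`, `μ(g) ≤ n`, `λ(g) = r`), **`etaCharIdeal_eq_span_C_pow_mul_of_namedFacts_of_minimalShape`** (the crux's frame, any row: CONDITIONAL
on Kob 1.2/1.3/2.2η/4.1η, `coeff_{rank V} L_p⁺(V) ≠ 0`, and the shape).

HONEST FRAMING (cell `bsd-potss`; FULL-BSD rank ≤ 1 programme, HUMAN RULING D-0036/D-0074): TOOL THEOREMS ONLY, CONDITIONAL on the named Literature
facts in hypothesis position and on the per-pair certificates (`coeff_{rank V} L_p⁺(V) ≠ 0`, the shape `Lη = u·T^{rank W}` — kit evidence per row,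
supplied here for NO row); `μ_alg = 0` is NOT claimed; crux 19606 and the route OPEN; nothing booked. `--supports stmt-BirchSwinnertonDyer-19606`.

References: [Kobayashi2003] Thm. 1.2 / 1.3 (p. 2), Thm. 2.2 (p. 5), §4 + Thm. 4.1 (p. 8); [GreenbergVatsal2000] p. 4; [Washington1997] §7.1.
Tree: Parts XXXII, XXXVIII.
-/

set_option autoImplicit false
set_option linter.dupNamespace false
noncomputable section

open scoped Classical

open CongruenceSubgroup Field WeierstrassCurve
open Literature.NumberTheory.EllipticCurves
open Literature.NumberTheory.EllipticCurves.ModularForms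
open Literature.NumberTheory.GaloisRepresentations
open Literature.NumberTheory.EllipticCurves.IwasawaAlgebra
open Summit.BirchSwinnertonDyer.Rank1Residual.Additive
open Summit.BirchSwinnertonDyer.Rank1Residual.X1.MuLambda (mu lam)

namespace Summit.BirchSwinnertonDyer.BirchSwinnertonDyer.Theorems.EtaThetaFunctionalEquation

/-! ## §115 `L = u·T^r`: every `g` with `T^r ∣ g ∣ pⁿL` is `p^{μ(g)}·T^r·unit` -/

section Algebra

variable {p : ℕ} [hp : Fact p.Prime]

/-- A monic divisor of `T^r` in `ℤ_p[T]` is `T^j` with `j ≤ r` (`T` is prime). [folklore] -/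
theorem eq_X_pow_of_monic_dvd_X_pow {P : Polynomial ℤ_[p]} (hP : P.Monic) {r : ℕ} (h : P ∣ Polynomial.X ^ r) :
    ∃ j ≤ r, P = Polynomial.X ^ j := by
  obtain ⟨j, hj, hass⟩ := (dvd_prime_pow Polynomial.prime_X r).mp h
  exact ⟨j, hj, Polynomial.eq_of_monic_of_associated hP (Polynomial.monic_X_pow j) hass⟩

/-- **MINIMAL SHAPE ⟹ `(g) = (p^{μ(g)}·L)`.** In `Λ = ℤ_p⟦T⟧`: if `L = u·T^r` with `u ∈ Λˣ` and `T^r ∣ g ∣ pⁿ·L`, then `μ(g) ≤ n`, `λ(g) = r` and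
**`(g) = (p^{μ(g)}·L)`** (the Weierstrass polynomial of `g` divides `T^r` and is divisible by `T^r`). No functional equation needed.
[cite: Washington1997, §7.1 (Thm. 7.3)] [cite: GreenbergVatsal2000, p. 4] -/
theorem span_eq_C_pow_mul_of_minimalShape {g L u : IwasawaAlgebra p} {r : ℕ} (hu : IsUnit u) (hL : L = u * PowerSeries.X ^ r)
    (hXg : (PowerSeries.X : IwasawaAlgebra p) ^ r ∣ g) {n : ℕ} (hgL : g ∣ PowerSeries.C ((p : ℤ_[p]) ^ n) * L) :
    mu g ≤ n ∧ lam g = r ∧ Ideal.span {g} = Ideal.span {PowerSeries.C ((p : ℤ_[p]) ^ mu g) * L} := by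
  -- Weierstrass data: `pⁿL = pⁿ · T^r · u`, and `g = p^{μ g} · P_g · U_g`
  have hPL : (Polynomial.X ^ r : Polynomial ℤ_[p]).IsDistinguishedAt (IsLocalRing.maximalIdeal ℤ_[p]) := isDistinguishedAt_X_pow' r
  have hLW : PowerSeries.C ((p : ℤ_[p]) ^ n) * L =
      PowerSeries.C ((p : ℤ_[p]) ^ n) * ((Polynomial.X ^ r : Polynomial ℤ_[p]) : IwasawaAlgebra p) * u := by
    rw [hL, Polynomial.coe_pow, Polynomial.coe_X]; ring
  have hpL0 : PowerSeries.C ((p : ℤ_[p]) ^ n) * L ≠ 0 := hLW ▸ weierstrass_ne_zero n hPL hu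
  have hg0 : g ≠ 0 := by
    rintro rfl
    obtain ⟨q, hq⟩ := hgL
    exact hpL0 (by rw [hq, zero_mul])
  obtain ⟨Pg, Ug, hPg, hUg, hdegPg, hgW⟩ := exists_weierstrass_of_ne_zero hg0
  generalize hm : mu g = m at hgW ⊢
  obtain ⟨hmn, hPdvd⟩ := (weierstrass_dvd_iff hPg hPL hUg hu hgW hLW).mp hgL
  obtain ⟨j, hjr, hPj⟩ := eq_X_pow_of_monic_dvd_X_pow hPg.monic hPdvd
  -- `T^r ∣ g` forces `j ≥ r`
  have hjr' : r ≤ j := by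
    obtain ⟨q, hq⟩ := hXg
    have hq0 : q ≠ 0 := fun h ↦ hg0 (by rw [hq, h, mul_zero])
    have h1 : ((r : ℕ) : ℕ∞) ≤ PowerSeries.order g := by rw [hq, PowerSeries.order_mul, PowerSeries.order_X_pow]; exact le_self_add
    have h2 : PowerSeries.order g = (j : ℕ) := by
      rw [order_of_weierstrass hUg hgW, hPj, Polynomial.coe_pow, Polynomial.coe_X, PowerSeries.order_X_pow]
    rw [h2, Nat.cast_le] at h1
    exact h1
  have hj : j = r := le_antisymm hjr hjr'
  subst hj
  refine ⟨hmn, by rw [← hdegPg, hPj, Polynomial.natDegree_X_pow], ?_⟩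
  have e1 : Associated (PowerSeries.C ((p : ℤ_[p]) ^ m) * ((Polynomial.X ^ j : Polynomial ℤ_[p]) : IwasawaAlgebra p))
      (PowerSeries.C ((p : ℤ_[p]) ^ m) * ((Polynomial.X ^ j : Polynomial ℤ_[p]) : IwasawaAlgebra p) * Ug) := associated_mul_unit_right _ Ug hUg
  have e2 : Associated (PowerSeries.C ((p : ℤ_[p]) ^ m) * ((Polynomial.X ^ j : Polynomial ℤ_[p]) : IwasawaAlgebra p))
      (PowerSeries.C ((p : ℤ_[p]) ^ m) * ((Polynomial.X ^ j : Polynomial ℤ_[p]) : IwasawaAlgebra p) * u) := associated_mul_unit_right _ u hu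
  have hpL : PowerSeries.C ((p : ℤ_[p]) ^ m) * L =
      PowerSeries.C ((p : ℤ_[p]) ^ m) * ((Polynomial.X ^ j : Polynomial ℤ_[p]) : IwasawaAlgebra p) * u := by
    rw [hL, Polynomial.coe_pow, Polynomial.coe_X]; ring
  rw [hgW, hPj, hpL]
  exact Ideal.span_singleton_eq_span_singleton.mpr (e1.symm.trans e2)

end Algebra

/-! ## §116 On the crux's frame: the minimal-`λ` rows, onto or not -/

section Pair

variable {V : WeierstrassCurve ℚ} [V.IsElliptic] [V.IsGloballyMinimal] {p : ℕ} [hp : Fact p.Prime]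

/-- **THE `η`-MAIN CONJECTURE UP TO `p^{μ_alg}` ON A MINIMAL-`λ` ROW (onto or not).** GRANTED Kobayashi's Thm. 1.2, 1.3 (`pⁿ`-clause), 2.2η and
4.1η (`pⁿ`-clause) (NAMED facts, hypothesis position), `p ≥ 5` good with `a_p(V) = 0`, `coeff_{rank V} L_p⁺(V) ≠ 0`, and the ANALYTIC SHAPE
**`Lη = u·T^{rank V^{(p*)}(ℚ)}`**, `u ∈ Λˣ` (`μ_an = 0`, `λ_an = rank W`: the `k = 0` rows — in P-31F all eight are CM, hence rows of THIS crux):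
every generator `g` of `Char X^η(D)` has `λ(g) = rank W`, `μ(g) ≤ n`, and **`Char X^η(D) = (p^{μ(g)}·Lη)`**; in particular (C1⁺_η) at the datum
⟺ `μ(g) = 0`. NO Kim 3.11η, NO (A), NO algebraic input. CONDITIONAL on the displayed inputs; `μ_alg = 0` is not claimed.
[cite: Kobayashi2003, Thm. 1.2 and Thm. 1.3 (p. 2), Thm. 2.2 (p. 5), §4 + Thm. 4.1 (p. 8)] [cite: GreenbergVatsal2000, p. 4] -/
theorem etaCharIdeal_eq_span_C_pow_mul_of_namedFacts_of_minimalShape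
    (h12 : Kobayashi2003.thm12_signedSelmerDual_finite_torsion)
    (h13 : Kobayashi2003.thm41_signedCharIdeal_divisibility)
    (h22 : Kobayashi2003.thm22_etaSignedSelmerDual_finite_torsion)
    (h41 : Kobayashi2003.thm41_plusEtaCharIdeal_dvd)
    (hp5 : 5 ≤ p) (hgood : V.HasGoodReductionAtPrime p) (hap : V.frobeniusTrace p = 0)
    (hcertV : ∀ {N : ℕ} [NeZero N] (f : CuspForm (Gamma0 N) 2), IsNewformOf V f →
      ∃ L : IwasawaAlgebra p, Kobayashi2003.IsSignedPAdicLFunction f p 1 L ∧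
        PowerSeries.coeff V.mordellWeilRank L ≠ 0)
    {N : ℕ} [NeZero N] {f : CuspForm (Gamma0 N) 2} (hf : IsNewformOf V f) (ϖ : ℚ)
    (hϖ : if Even (p / 2) then (ϖ : ℝ) * V.realPeriodRat = plusPeriod f
      else (ϖ : ℝ) * V.imaginaryPeriodRat = minusPeriod f)
    (Lη : IwasawaAlgebra p) (hL : IsQuadraticBranchPlusLFunction f p ϖ Lη)
    {u : IwasawaAlgebra p} (hu : IsUnit u) (hLs : Lη = u * PowerSeries.X ^ (V.quadraticTwist ((-1) ^ (p / 2) * p)).mordellWeilRank)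
    (K₀ : Type) [Field K₀] [NumberField K₀] [IsCyclotomicExtension {p} ℚ K₀]
    [(galRange (K := ℚ) K₀).Normal] (ηq : absoluteGaloisGroup ℚ →* ℤˣ)
    (hηK : ∀ σ ∈ galRange (K := ℚ) K₀, ηq σ = 1) (hη1 : ηq ≠ 1)
    (κ : ZpExtension ℚ p) (γ : absoluteGaloisGroup ℚ) (hκ : κ.IsCyclotomic) (hγ : κ.IsTopGenerator γ)
    (hγK : γ ∈ galRange (K := ℚ) K₀) (hγc : IsCyclotomicVariable p γ)
    (D : EtaSignedSelmerDualData V κ K₀ ℚ_[p] ηq γ 1) {g : IwasawaAlgebra p}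
    (hg : D.charIdeal = Ideal.span {g}) :
    ∃ n : ℕ, mu g ≤ n ∧ lam g = (V.quadraticTwist ((-1) ^ (p / 2) * p)).mordellWeilRank ∧
      D.charIdeal = Ideal.span {PowerSeries.C ((p : ℤ_[p]) ^ mu g) * Lη} := by
  have hp2 : p ≠ 2 := by omega
  have hXg := X_pow_twistRank_dvd_etaCharGenerator_of_namedFacts_of_coeff_ne_zero h12 h13 h22 hp5 hgood hap
    (fun f hf => hcertV f hf) hf K₀ ηq hηK hη1 κ γ hκ hγ hγK hγc D hg
  obtain ⟨hfin, htor⟩ :=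
    EtaSignedSelmerDualData.finite_isTorsion_of_thm22 h22 hηK hp2 hgood hap hκ hγ hγK D
  obtain ⟨⟨n, hn⟩, -⟩ := h41 p K₀ ηq hηK hη1 V hp2 hgood hap hf ϖ hϖ Lη hL κ γ hκ hγ hγK hγc D.toLiterature hfin htor
  rw [EtaSignedSelmerDualData.charIdeal_toLiterature, hg, natCast_pow_mul_mem_span_singleton_iff] at hn
  obtain ⟨hmu, hlam, hspan⟩ := span_eq_C_pow_mul_of_minimalShape hu hLs hXg hn
  exact ⟨n, hmu, hlam, by rw [hg, hspan]⟩

end Pair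

end Summit.BirchSwinnertonDyer.BirchSwinnertonDyer.Theorems.EtaThetaFunctionalEquation

end
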